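import Mathlib
import HarnessLib
import Summits.Ventures.LatticeQCDFlow.Scaling.MixedPowerCostExponent

/-!
# An exponential law has no scaling exponent: the two-point exponent of `τ = A·e^{c x}` between scales `x₁ < x₂` is `c(x₂ − x₁)/log(x₂/x₁)`, bracketed by `c·x₁` and `c·x₂` — so it GROWS along the scale axis

HONEST FRAMING: exact (Metropolis-corrected) sampling algorithms for lattice gauge theory;
figures of merit are autocorrelation/cost numbers at stated couplings and volumes; no
continuum-physics claim.

Venture `LatticeQCDFlow` (cell pub-lqcd), topic `Scaling`, FANOUT row 21 (`su3-base`).  Acceptance item (g) of the row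
(HOME/su3-base/CARD-su3-base.md §7) asks for TWO fits of the measured `τ_int(Q²)` against the scale `x = 1/a`: a power law
`τ ∝ x^z` and an exponential law `τ ∝ e^{c x}` (the printed laws it is compared with are of both kinds — a dynamical exponent
`z ≈ 5` for HMC, and Del Debbio–Panagopoulos–Vicari's `ln τ` linear in `ξ_σ ∝ 1/a` for heat bath + over-relaxation), and
reports the "two-point exponents" between consecutive points.  This file is the elementary dictionary between the two, over
Mathlib and the tree's `Scaling.secantExponent` (row 19, `MixedPowerCostExponent.lean`: `secantExponent C x₁ x₂ =
log(C x₂/C x₁)/log(x₂/x₁)`, `secantExponent_pure` for power laws): OUR WORK, no definition, nothing cited as a fact, no number.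

* **`secantExponent_expLaw`** — for `C x = A·e^{c x}` (`A > 0`): `secantExponent C x₁ x₂ = c (x₂ − x₁)/log(x₂/x₁)`.
* `sub_div_log_div_mem_Icc` — `x₁ ≤ (x₂ − x₁)/log(x₂/x₁) ≤ x₂` (the logarithmic mean lies between its arguments; from
  `log r ≤ r − 1` and `1 − 1/r ≤ log r`); hence **`secantExponent_expLaw_mem_Icc`** — for `c ≥ 0`:
  `c·x₁ ≤ secantExponent C x₁ x₂ ≤ c·x₂`.
* **`secantExponent_expLaw_lt_of_lt`** — THE SIGNATURE: for `c > 0` and three scales `x₁ < x₂ < x₃`, the two-point exponent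
  of the pair `(x₁, x₂)` is STRICTLY SMALLER than that of `(x₂, x₃)` (the first is `≤ c x₂`, the second `≥ c x₂`, and the
  logarithmic mean is strict).  A power law has equal two-point exponents on every pair (`secantExponent_pure`); an
  exponential law has strictly increasing ones — with three points (P0, S2, P1) the two fits of (g) are distinguished by
  whether the two consecutive two-point exponents agree within errors or increase.
NOT CLAIMED: which law the row's data follow; any value of `c`, `z`, `a(β)`; error propagation (row 21's
`Scaling/SecantExponentErrorBar`).
-/

namespace Summit.Ventures.LatticeQCDFlow.Scaling

open Real

/-- **The two-point exponent of an exponential law**: `secantExponent (A·e^{c·}) x₁ x₂ = c(x₂ − x₁)/log(x₂/x₁)` (any `x₁, x₂`;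
meaningful for `0 < x₁ < x₂`). -/
theorem secantExponent_expLaw {A c : ℝ} (hA : 0 < A) (x₁ x₂ : ℝ) :
    secantExponent (fun x => A * Real.exp (c * x)) x₁ x₂ = c * (x₂ - x₁) / Real.log (x₂ / x₁) := by
  unfold secantExponent
  congr 1
  rw [mul_div_mul_left _ _ hA.ne', ← Real.exp_sub, Real.log_exp]
  ring

/-- **The logarithmic mean lies between its arguments**: `x₁ ≤ (x₂ − x₁)/log(x₂/x₁) ≤ x₂` for `0 < x₁ < x₂`. -/
theorem sub_div_log_div_mem_Icc {x₁ x₂ : ℝ} (hx₁ : 0 < x₁) (hx : x₁ < x₂) :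
    x₁ ≤ (x₂ - x₁) / Real.log (x₂ / x₁) ∧ (x₂ - x₁) / Real.log (x₂ / x₁) ≤ x₂ := by
  have hx₂ : 0 < x₂ := hx₁.trans hx
  have hr : 1 < x₂ / x₁ := (one_lt_div hx₁).2 hx
  have hlog : 0 < Real.log (x₂ / x₁) := Real.log_pos hr
  -- `log r ≤ r − 1`
  have hup : Real.log (x₂ / x₁) ≤ x₂ / x₁ - 1 := Real.log_le_sub_one_of_pos (by positivity)
  -- `1 − 1/r ≤ log r`
  have hlo : 1 - (x₂ / x₁)⁻¹ ≤ Real.log (x₂ / x₁) := by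
    have h := Real.log_le_sub_one_of_pos (show 0 < (x₂ / x₁)⁻¹ by positivity)
    rw [Real.log_inv] at h
    linarith
  constructor
  · rw [le_div_iff₀ hlog]
    have : x₁ * (x₂ / x₁ - 1) = x₂ - x₁ := by field_simp
    nlinarith
  · rw [div_le_iff₀ hlog]
    have e : x₂ * (1 - (x₂ / x₁)⁻¹) = x₂ - x₁ := by
      rw [inv_div]; field_simp
    nlinarith

/-- **`c·x₁ ≤ secantExponent (A·e^{c·}) x₁ x₂ ≤ c·x₂`** for `c ≥ 0`: the local exponent of an exponential law between two scales is
`c` times a mean of the scales. -/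
theorem secantExponent_expLaw_mem_Icc {A c x₁ x₂ : ℝ} (hA : 0 < A) (hc : 0 ≤ c) (hx₁ : 0 < x₁) (hx : x₁ < x₂) :
    c * x₁ ≤ secantExponent (fun x => A * Real.exp (c * x)) x₁ x₂ ∧
      secantExponent (fun x => A * Real.exp (c * x)) x₁ x₂ ≤ c * x₂ := by
  rw [secantExponent_expLaw hA x₁ x₂, mul_div_assoc]
  obtain ⟨h1, h2⟩ := sub_div_log_div_mem_Icc hx₁ hx
  exact ⟨mul_le_mul_of_nonneg_left h1 hc, mul_le_mul_of_nonneg_left h2 hc⟩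

/-- The logarithmic mean is STRICTLY below the larger argument. -/
theorem sub_div_log_div_lt {x₁ x₂ : ℝ} (hx₁ : 0 < x₁) (hx : x₁ < x₂) : (x₂ - x₁) / Real.log (x₂ / x₁) < x₂ := by
  have hx₂ : 0 < x₂ := hx₁.trans hx
  have hr : 1 < x₂ / x₁ := (one_lt_div hx₁).2 hx
  have hlog : 0 < Real.log (x₂ / x₁) := Real.log_pos hr
  -- strict: `1 − 1/r < log r` for `r ≠ 1`
  have hlo : 1 - (x₂ / x₁)⁻¹ < Real.log (x₂ / x₁) := by
    have hne : (x₂ / x₁)⁻¹ ≠ 1 := by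
      rw [Ne, inv_eq_one]; exact ne_of_gt hr
    have h := Real.log_lt_sub_one_of_pos (show 0 < (x₂ / x₁)⁻¹ by positivity) hne
    rw [Real.log_inv] at h
    linarith
  rw [div_lt_iff₀ hlog]
  have e : x₂ * (1 - (x₂ / x₁)⁻¹) = x₂ - x₁ := by
    rw [inv_div]; field_simp
  nlinarith

/-- The logarithmic mean is STRICTLY above the smaller argument. -/
theorem lt_sub_div_log_div {x₁ x₂ : ℝ} (hx₁ : 0 < x₁) (hx : x₁ < x₂) : x₁ < (x₂ - x₁) / Real.log (x₂ / x₁) := by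
  have hr : 1 < x₂ / x₁ := (one_lt_div hx₁).2 hx
  have hlog : 0 < Real.log (x₂ / x₁) := Real.log_pos hr
  have hup : Real.log (x₂ / x₁) < x₂ / x₁ - 1 :=
    Real.log_lt_sub_one_of_pos (by positivity) (ne_of_gt hr)
  rw [lt_div_iff₀ hlog]
  have : x₁ * (x₂ / x₁ - 1) = x₂ - x₁ := by field_simp
  nlinarith

/-- **THE SIGNATURE OF AN EXPONENTIAL LAW: its consecutive two-point exponents STRICTLY INCREASE.**  For `c > 0`, `A > 0` and
three scales `0 < x₁ < x₂ < x₃`: `secantExponent C x₁ x₂ < secantExponent C x₂ x₃` for `C x = A·e^{c x}` (whereas a power law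
has the same exponent on every pair, `secantExponent_pure`). -/
theorem secantExponent_expLaw_lt_of_lt {A c x₁ x₂ x₃ : ℝ} (hA : 0 < A) (hc : 0 < c) (hx₁ : 0 < x₁) (h12 : x₁ < x₂)
    (h23 : x₂ < x₃) :
    secantExponent (fun x => A * Real.exp (c * x)) x₁ x₂ < secantExponent (fun x => A * Real.exp (c * x)) x₂ x₃ := by
  have hx₂ : 0 < x₂ := hx₁.trans h12
  rw [secantExponent_expLaw hA x₁ x₂, secantExponent_expLaw hA x₂ x₃, mul_div_assoc, mul_div_assoc]
  exact mul_lt_mul_of_pos_left ((sub_div_log_div_lt hx₁ h12).trans (lt_sub_div_log_div hx₂ h23)) hc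

/-- For contrast (the tree's `secantExponent_pure`, restated for three scales): a power law `C x = k·x^p` has EQUAL two-point
exponents on the pairs `(x₁, x₂)` and `(x₂, x₃)`. -/
theorem secantExponent_powLaw_eq {k p x₁ x₂ x₃ : ℝ} (hk : 0 < k) (hx₁ : 0 < x₁) (h12 : x₁ < x₂) (h23 : x₂ < x₃) :
    secantExponent (fun x => k * x ^ p) x₁ x₂ = secantExponent (fun x => k * x ^ p) x₂ x₃ := by
  rw [secantExponent_pure hk hx₁ h12, secantExponent_pure hk (hx₁.trans h12) h23]

end Summit.Ventures.LatticeQCDFlow.Scaling
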